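import Summits.ValiantsHypothesis.ValiantsHypothesis.Theorems.LangWeilTransferTameResolutionFactorWeightPrelims
import Literature.Computability.AlgebraicComplexity.BurgisserBooleanPartsA3Assembly

/-!
# LangWeilTransfer, support item `TameResolution` (stmt-ValiantsHypothesis-6378) — flattening
# `ℤ[X_1..X_k][U] ≅ ℤ[X_0..X_k]` and the sizes of coefficients versus the flat polynomial

Route `LangWeilTransfer` of `ValiantsHypothesis` (conditional route; honest framing: bookkeeping,
nothing here bears on VP ≠ VNP). Quantitative pass (roadmap note of val-lit-p6 g9, §1(B)): the
factor steps `q ∣ 𝒬_a` and `Q ∣ q_c` of `exists_parametrisation_explicit` are used through the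
factor weight bound `log_weight_le_of_dvd` of `LangWeilTransferTameResolutionFactorWeight`, which
lives on flat rings `ℤ[Fin k]`. This file relates the sizes of `P ∈ ℤ[X_1..X_k][U]` (its
`U`-degree and the weights / total degrees of its coefficients) to those of the flat polynomial
`(finSuccEquiv ℤ k)⁻¹ P ∈ ℤ[X_0..X_k]`, in both directions.

* `finSuccEquiv_symm_eq_sum` — `(finSuccEquiv)⁻¹ P = Σ_i rename succ (P.coeff i) · X_0^i`;
* `totalDegree_finSuccEquiv_symm_le`, `weight_finSuccEquiv_symm_le` — flat sizes from coefficient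
  sizes;
* `totalDegree_coeff_le_flat`, `weight_coeff_le_flat`, `natDegree_le_totalDegree_flat` —
  coefficient sizes from flat sizes.
-/

noncomputable section

open MvPolynomial
open Literature.Computability.AlgebraicComplexity

-- the summit and the problem share the name `ValiantsHypothesis` (D-0017 single-conjunct layout)
set_option linter.dupNamespace false

namespace Summit.ValiantsHypothesis.ValiantsHypothesis.Theorems.LangWeilTransfer

variable {k : ℕ}

/-- `(finSuccEquiv ℤ k)⁻¹ P = Σ_{i ∈ supp P} rename succ (P.coeff i) · X_0 ^ i`. -/
theorem finSuccEquiv_symm_eq_sum (P : Polynomial (MvPolynomial (Fin k) ℤ)) :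
    (finSuccEquiv ℤ k).symm P = ∑ i ∈ P.support, rename Fin.succ (P.coeff i) * X 0 ^ i := by
  conv_lhs => rw [P.as_sum_support_C_mul_X_pow]
  rw [map_sum]
  refine Finset.sum_congr rfl fun i _ => ?_
  rw [map_mul, map_pow, finSuccEquiv_symm_C, finSuccEquiv_symm_X]

/-- **Total degree of the flat polynomial** from the `U`-degree and the coefficient degrees. -/
theorem totalDegree_finSuccEquiv_symm_le (P : Polynomial (MvPolynomial (Fin k) ℤ)) {N D : ℕ}
    (hN : P.natDegree ≤ N) (hD : ∀ i, (P.coeff i).totalDegree ≤ D) :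
    ((finSuccEquiv ℤ k).symm P).totalDegree ≤ D + N := by
  rw [finSuccEquiv_symm_eq_sum]
  refine totalDegree_finsetSum_le fun i hi => ?_
  refine (totalDegree_mul _ _).trans (Nat.add_le_add ((totalDegree_rename_le _ _).trans (hD i)) ?_)
  refine (totalDegree_pow _ _).trans ?_
  rw [totalDegree_X, mul_one]
  exact (Polynomial.le_natDegree_of_mem_supp i hi).trans hN

/-- **Weight of the flat polynomial** from the `U`-degree and the coefficient weights. -/
theorem weight_finSuccEquiv_symm_le (P : Polynomial (MvPolynomial (Fin k) ℤ)) {N W : ℕ}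
    (hN : P.natDegree ≤ N) (hW : ∀ i, weight (P.coeff i) ≤ W) :
    weight ((finSuccEquiv ℤ k).symm P) ≤ (N + 1) * W := by
  rw [finSuccEquiv_symm_eq_sum]
  refine (weight_finset_sum_le _ _).trans ?_
  have hX : weight (X (0 : Fin (k + 1)) : MvPolynomial (Fin (k + 1)) ℤ) = 1 := by
    rw [show (X 0 : MvPolynomial (Fin (k + 1)) ℤ) = monomial (Finsupp.single 0 1) 1 from rfl, weight_monomial]; rfl
  calc ∑ i ∈ P.support, weight (rename Fin.succ (P.coeff i) * X 0 ^ i)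
      ≤ ∑ i ∈ P.support, W := by
        refine Finset.sum_le_sum fun i _ => ?_
        refine (weight_mul_le _ _).trans ?_
        rw [weight_rename_of_injective (Fin.succ_injective k)]
        refine (Nat.mul_le_mul (hW i) (weight_pow_le _ _)).trans ?_
        rw [hX, one_pow, mul_one]
    _ = P.support.card * W := by rw [Finset.sum_const, smul_eq_mul]
    _ ≤ (N + 1) * W := by
        refine Nat.mul_le_mul_right _ ?_
        calc P.support.card ≤ (Finset.range (P.natDegree + 1)).card :=
              Finset.card_le_card Polynomial.supp_subset_range_natDegree_succ
          _ = P.natDegree + 1 := Finset.card_range _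
          _ ≤ N + 1 := Nat.add_le_add_right hN 1

/-- **Coefficient degrees from the flat total degree.** -/
theorem totalDegree_coeff_le_flat (P : Polynomial (MvPolynomial (Fin k) ℤ)) (i : ℕ) :
    (P.coeff i).totalDegree ≤ ((finSuccEquiv ℤ k).symm P).totalDegree := by
  by_cases hi : P.coeff i = 0
  · rw [hi, totalDegree_zero]; exact Nat.zero_le _
  · have h := totalDegree_coeff_finSuccEquiv_add_le ((finSuccEquiv ℤ k).symm P) i
      (by rw [AlgEquiv.apply_symm_apply]; exact hi)
    rw [AlgEquiv.apply_symm_apply] at h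
    omega

/-- **`U`-degree from the flat total degree.** -/
theorem natDegree_le_totalDegree_flat (P : Polynomial (MvPolynomial (Fin k) ℤ)) :
    P.natDegree ≤ ((finSuccEquiv ℤ k).symm P).totalDegree := by
  have h := natDegree_finSuccEquiv ((finSuccEquiv ℤ k).symm P)
  rw [AlgEquiv.apply_symm_apply] at h
  rw [h]
  exact degreeOf_le_totalDegree _ _

/-- **Coefficient weights from the flat weight.** -/
theorem weight_coeff_le_flat (P : Polynomial (MvPolynomial (Fin k) ℤ)) (i : ℕ) :
    weight (P.coeff i) ≤ weight ((finSuccEquiv ℤ k).symm P) := by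
  rw [weight_eq_sum_weight_coeff ((finSuccEquiv ℤ k).symm P), AlgEquiv.apply_symm_apply]
  by_cases hi : i ∈ P.support
  · exact Finset.single_le_sum (f := fun j => weight (P.coeff j)) (fun _ _ => Nat.zero_le _) hi
  · rw [Polynomial.notMem_support_iff.1 hi, weight_zero]; exact Nat.zero_le _

/-- **Per-variable degrees from the flat total degree** (the hypothesis shape of
`log_weight_le_of_dvd`). -/
theorem degreeOf_flat_le (P : Polynomial (MvPolynomial (Fin k) ℤ)) (v : Fin (k + 1)) :
    degreeOf v ((finSuccEquiv ℤ k).symm P) ≤ ((finSuccEquiv ℤ k).symm P).totalDegree :=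
  degreeOf_le_totalDegree _ _

end Summit.ValiantsHypothesis.ValiantsHypothesis.Theorems.LangWeilTransfer
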